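import Literature.MathematicalPhysics.QuantumFieldTheory.BalabanImbrieJaffe1984to88.BIJ88Eq531TranslLaw
import Literature.MathematicalPhysics.QuantumFieldTheory.BalabanImbrieJaffe1984to88.BIJ88Eq536Linearization

/-!
# `BalabanImbrieJaffe1984to88.BIJ88Eq531TranslLawCutoff` — T. Bałaban, J. Imbrie, A. Jaffe, *Effective action and cluster properties of
the abelian Higgs model*, Commun. Math. Phys. **114** (1988) 257–315 [BalabanImbrieJaffe1988], (5.3.1)/(5.3.6) p. 280 (and (3.24) p. 269):
**the first gauge-field translation WITH ITS CUT-OFF, `u = u′(Λ₁^{(k)*}Q^{s*}v)`, AT THE LEVEL OF THE MEASURE** on the torus of record.  The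
companion `BIJ88Eq531TranslLaw` treats the whole-torus case (no large-field region); here the cut-off `Λ` (= the `L`-lattice bonds
`Λ₁^{(k)′*}` carrying the δ-functions that are translated, p31's `BIJ88Eq536Linearization.cutoff`) is arbitrary: with the translated variable
`u′_Λ = u·Q^{s*}(cut-off·(Qu)⁻¹)` one has `u = u′_Λ·Q^{s*}(cut-off·Qu)`, `Q(u′_Λ·Q^{s*}(cut-off·v))` is `v` ON `Λ` and `Qu` OFF `Λ` — (5.3.6):
*"δ(v/Qu) = δ_{Λ₁^{(k)′*c}}(v/Qu) δ_{Λ₁^{(k)′*}}(…)"*, the `Λ`-components of `v` leave the δ-functions, the complement stays — and for every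
probability law `ν` of `u` invariant under the substitutions `u ↦ u·Q^{s*}w` (`𝒟u`, `𝒟u δ_{Ax}(u)`): `law(u′_Λ, cut-off·Qu) = law(u′_Λ) ⊗
(cut-off)_*dv`, the translation `(u, v) ↦ u′_Λ(u)·Q^{s*}(cut-off·v)` is measure preserving `ν ⊗ dv → ν`, and `∫ν F(u) g(Qu) = ∫ν ∫dv
F(u′_Λ·Q^{s*}(cut-off·v)) g(v|_Λ, Qu|_{Λᶜ})`.

statement-level skeleton of published theorems with citation tags; proofs where landed; nothing here is a claim about the Yang–Mills mass gap

PDF held: `paper:balaban1988-cmp114-bij-abelian-higgs-effective-action` (journal page = PDF page + 256); p. 280 [PDF 24] (r16's render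
`HOME/lit-balaban-r16/renders/cmp114/original-p024-x2.png`), p. 269 [PDF 13] (this seat's render `renders/original-p013-x2.png`).

CITATION HEADER (lean-in-tree rule).  Part of the lit-balaban TYPED SKELETON (HOME `run/shared/lean/pub/lit-balaban/`), PHASE-2 proof seat p34
gen 7 (unit `lit-balaban-p34-g7`; TAKING line HOME/STATUS.md 2026-08-21T11:45:44Z, free-target protocol G.5-34(d), own lineage = the C1/C2
renormalization-transformation line).  Rows served (support): `C2.Eq5.3.1-5.3.7` of `HOME/lit-balaban-r16/ROWS-C2-part2.md` (owner r16),
`C2.Eq3.24` of `HOME/lit-balaban-r18/ROWS-C2.md` (owner r18).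

THE PRINTED TEXT (verbatim, p. 280 [PDF 24]).  *"5.3. First Gauge Field Translation. The first translation is done in Λ₁^{(k)*}, and it removes
the v-field from the δ-functions there. As in (3.24) we put u = u′(Λ₁^{(k)*}Q^{s*}v), (5.3.1) cf. also (I.6.2). … The translation affects the
δ-functions as follows. δ_{Ax}(u) = δ_{Ax}(u′), δ(v/Qu) = δ_{Λ₁^{(k)′*c}}(v/Qu) δ_{Λ₁^{(k)′*}}((e_k/2π)QA′), (5.3.6) where δ_{Λ₁^{(k)′*}}((e_k/2π)QA′)
= Π_{b′∈Λ₁^{(k)′*}} δ((e_k/2π)(QA′)(b′)). (5.3.7)"*; p. 269 [PDF 13]: *"u_b = u′_bu_{b′}, if b ∈ B^s(b′) ∩ Λ₁^{(0)*}, u′_b, otherwise. ≡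
u′_b(Λ₁^{(0)*}Q^{s*}v)_b, (3.24) where the prefactor Λ₁^{(0)*} indicates that what follows is present only for b ∈ Λ₁^{(0)*}."*

THE READING (all carriers of record; nothing re-declared; as in `BIJ88Eq531TranslLaw`).  `𝒟u = fieldMeasure P j U1`, `dv = fieldMeasure P
(j+1) U1`, `𝒟u δ_{Ax}(u)` = r18's `axialMeasure`; `Q` = r18's `qU` ([2] (2.10)); `u·Q^{s*}w` = r18's `surfMul u w`; the cut-off is read on the
`L`-lattice bonds `Λ` exactly as in p31's `BIJ88Eq536Linearization` (`cutoff Λ v` = `v` on `Λ`, `1` off `Λ`; for `Λ₁` a union of blocks a surface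
bond lies in `Λ₁^{(k)*}` iff its block bond lies in `Λ₁^{(k)′*}`, p31's `toC_transl_eq_transl531`), so that (5.3.1) is `u = surfMul u′ (cutoff Λ v)`;
THE TRANSLATED VARIABLE `u′_Λ := surfMul u (cutoff Λ (Qu)⁻¹)` (written out in every statement; for `Λ` = all bonds it is r18's `uPrime` = [2]
(3.9), `uCut_univ`) — the variable in which *"δ(v/Qu)"* on `Λ` becomes *"δ(Qu′) = δ(QA′)"*: `Q(u′_Λ) = 1` on `Λ` (`cutoff_qU_uCut`).

WHAT IS PROVED (kernel-checked; theorems only, no `def`, no `Prop`-valued fact; standard axioms).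
* §1 THE CUT-OFF: `cutoff_apply`, `cutoff_univ`, `cutoff_cutoff`, `cutoff_mul`, `measurable_cutoff` (API over p31's `cutoff`).
* §2 THE TRANSLATED VARIABLE AND THE TRANSLATION, field by field: `qU_uCut` (`Q(u′_Λ)` = `1` on `Λ`, `Qu` off `Λ`), `cutoff_qU_uCut`,
  `qU_uCut_of_not_mem`, **`surfMul_uCut_cutoff_qU`** (`u = u′_Λ·Q^{s*}(cut-off·Qu)`: (5.3.1) solved by `(u′_Λ, v|_Λ = Qu|_Λ)`), **`uCut_surfMul_cutoff`**
  (`(u·Q^{s*}(cut-off·w))′_Λ = u′_Λ`), **`qU_translCut`** (`Q(u′_Λ·Q^{s*}(cut-off·v))` = `v` on `Λ`, `Qu` off `Λ` — (5.3.6) at field level: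
  `cutoff_qU_translCut`, `qU_translCut_of_not_mem`; p31's `qU_transl_of_mem`/`qU_transl_of_not_mem` are the same computation for an abstract `u′`),
  `uCut_univ`/`translCut_univ` (whole torus = the companion file), measurability (`measurable_uCut`, `measurable_graphCut`, `measurable_translCut`).
* §3 **THE JOINT LAW WITH CUT-OFF** for a substitution-invariant probability law `ν`: `lintegral_cutoff_qU_eq` (`∫ν J(u, cut-off·Qu) = ∫ν ∫dv J(u,
  cut-off·v)` for jointly measurable `J ≥ 0` with `J(u·Q^{s*}(cut-off·w), ·) = J(u, ·)`), **`map_graphCut_eq_prod`** (`law(u′_Λ, cut-off·Qu) =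
  law(u′_Λ) ⊗ (cut-off)_*dv`: the translated variable and the `Λ`-components of the block field are INDEPENDENT, the latter Haar),
  `measurePreserving_graphCut`, `map_translCut_prod`, **`measurePreserving_translCut`** (`(u, v) ↦ u′_Λ(u)·Q^{s*}(cut-off·v)` carries `ν ⊗ dv` onto `ν`).
* §4 INTEGRALS: `lintegral_eq_translCut`, **`integral_eq_translCut`** (`∫ν F = ∫ν ∫dv F(u′_Λ·Q^{s*}(cut-off·v))`), **`integral_mul_comp_qU_eq_translCut`**
  (`∫ν F(u) g(Qu) = ∫ν ∫dv F(u′_Λ·Q^{s*}(cut-off·v)) g(c ↦ v_c if c ∈ Λ, (Qu)_c if c ∉ Λ)` — *"it removes the v-field from the δ-functions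
  there"*: the factor `δ_{Λ′*}` is translated away, `δ_{Λ′*c}(v/Qu)` stays).
* §5 THE INSTANCES OF RECORD: `map_graphCut_axialMeasure`, `map_graphCut_fieldMeasure`, `integral_axialMeasure_eq_translCut`,
  `integral_mul_comp_qU_axialMeasure_cut`.
NOT DONE HERE (honest scope).  The rewriting of the remaining `u′_Λ`-integral in the variables `A′` with `δ((e_k/2π)QA′)` (5.3.7) (constraint
sets and the one-bond Jacobian: p31's `BIJ88Eq536Linearization` §4, `BIJ88Eq537Jacobian`); the densities of (5.1.1) after the cut-off
translation (the whole-torus case is this seat's `BIJ88Eq531TranslDensity`); the choice of `Λ₁^{(k)}` from the field restrictions (r16's §5.2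
files); bounds.  Imports this seat's `BIJ88Eq531TranslLaw` and p31's `BIJ88Eq536Linearization` (Literature + Mathlib only); re-declares nothing.
-/

namespace Literature.MathematicalPhysics.QuantumFieldTheory.BalabanImbrieJaffe1984to88.BIJ88Eq531TranslLawCutoff

open Literature.MathematicalPhysics.QuantumFieldTheory.Balaban1983to89
open BIJ88Sect3Statements (U1)
open BIJ88RenormTransf311 (axialMeasure)
open BIJ85BlockAveragesTorus (qU surfMul uPrime qU_surfMul measurable_qU map_surfMul_fieldMeasure)
open BIJ88Eq536Linearization (cutoff)
open BIJ88Eq531TranslLaw (surfMul_surfMul surfMul_one measurable_surfMul₂ lintegral_comp_surfMul axialMeasure_map_surfMul)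
open scoped BigOperators ENNReal
open _root_.MeasureTheory _root_.MeasureTheory.Measure Function

noncomputable section

variable {P : Params} {j : ℕ} {Λ : Finset (PBond P (j+1))}

/-! ## §1 The cut-off -/

/-- kernel: p31's cut-off unfolded — `v_c` for `c ∈ Λ`, `1` otherwise. [cite: BalabanImbrieJaffe1988, (5.3.1) p.280] -/
theorem cutoff_apply (Λ : Finset (PBond P (j+1))) (v : GaugeField P (j+1) U1) (c : PBond P (j+1)) :
    cutoff Λ v c = if c ∈ Λ then v c else 1 := rfl

/-- kernel: no cut-off (all bonds) is the identity — the whole-torus case of the companion file. [cite: BalabanImbrieJaffe1988, (5.3.1) p.280] -/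
theorem cutoff_univ (v : GaugeField P (j+1) U1) : cutoff Finset.univ v = v := by
  funext c; simp [cutoff_apply]

/-- kernel: the cut-off is idempotent. [cite: BalabanImbrieJaffe1988, (5.3.1) p.280] -/
theorem cutoff_cutoff (Λ : Finset (PBond P (j+1))) (v : GaugeField P (j+1) U1) : cutoff Λ (cutoff Λ v) = cutoff Λ v := by
  funext c; by_cases hc : c ∈ Λ <;> simp [cutoff_apply, hc]

/-- kernel: the cut-off is multiplicative. [cite: BalabanImbrieJaffe1988, (5.3.1) p.280] -/
theorem cutoff_mul (Λ : Finset (PBond P (j+1))) (v w : GaugeField P (j+1) U1) :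
    cutoff Λ (fun c => v c * w c) = fun c => cutoff Λ v c * cutoff Λ w c := by
  funext c; by_cases hc : c ∈ Λ <;> simp [cutoff_apply, hc]

/-- kernel: the cut-off is measurable. [cite: BalabanImbrieJaffe1988, (5.3.1) p.280] -/
theorem measurable_cutoff (Λ : Finset (PBond P (j+1))) : Measurable (cutoff Λ : GaugeField P (j+1) U1 → GaugeField P (j+1) U1) := by
  refine measurable_pi_iff.mpr fun c => ?_
  by_cases hc : c ∈ Λ
  · simp only [cutoff_apply, if_pos hc]; exact measurable_pi_apply c
  · simp only [cutoff_apply, if_neg hc]; exact measurable_const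

/-! ## §2 The translated variable `u′_Λ = u·Q^{s*}(cut-off·(Qu)⁻¹)` and the translation `u = u′_Λ·Q^{s*}(cut-off·v)` -/

/-- **`Q(u′_Λ)_c = 1` for `c ∈ Λ`, `= (Qu)_c` for `c ∉ Λ`** — in the translated variable the δ-function on `Λ` reads `δ(Qu′)` (= `δ(QA′)` after
(3.12): p31's `qU_phaseField_eq_one_iff`), off `Λ` nothing changes (r18's `qU_surfMul`; standing range). [cite: BalabanImbrieJaffe1988, (5.3.6) p.280] -/
theorem qU_uCut (hj : j + 1 ≤ P.m + P.K) (Λ : Finset (PBond P (j+1))) (U : GaugeField P j U1) :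
    qU (surfMul U (cutoff Λ (fun c => (qU U c)⁻¹))) = fun c => if c ∈ Λ then 1 else qU U c := by
  rw [qU_surfMul hj]
  funext c
  by_cases hc : c ∈ Λ
  · simp only [cutoff_apply, if_pos hc]; exact mul_inv_cancel _
  · simp only [cutoff_apply, if_neg hc, mul_one]

/-- `cut-off·Q(u′_Λ) = 1`: [2] (3.11) on the cut-off. [cite: BalabanImbrieJaffe1988, (5.3.6) p.280] -/
theorem cutoff_qU_uCut (hj : j + 1 ≤ P.m + P.K) (Λ : Finset (PBond P (j+1))) (U : GaugeField P j U1) :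
    cutoff Λ (qU (surfMul U (cutoff Λ (fun c => (qU U c)⁻¹)))) = 1 := by
  rw [qU_uCut hj]
  funext c
  show cutoff Λ _ c = (1 : U1)
  by_cases hc : c ∈ Λ <;> simp [cutoff_apply, hc]

/-- off the cut-off the translated variable has the block averages of `u`. [cite: BalabanImbrieJaffe1988, (5.3.6) p.280] -/
theorem qU_uCut_of_not_mem (hj : j + 1 ≤ P.m + P.K) (U : GaugeField P j U1) {c : PBond P (j+1)} (hc : c ∉ Λ) :
    qU (surfMul U (cutoff Λ (fun c => (qU U c)⁻¹))) c = qU U c := by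
  rw [qU_uCut hj]; simp [hc]

/-- **(5.3.1) solved by the pair `(u′_Λ(u), v|_Λ = Qu|_Λ)`: `u = u′_Λ·Q^{s*}(cut-off·Qu)`.** [cite: BalabanImbrieJaffe1988, (5.3.1) p.280] -/
theorem surfMul_uCut_cutoff_qU (Λ : Finset (PBond P (j+1))) (U : GaugeField P j U1) :
    surfMul (surfMul U (cutoff Λ (fun c => (qU U c)⁻¹))) (cutoff Λ (qU U)) = U := by
  rw [surfMul_surfMul]
  conv_rhs => rw [← surfMul_one U]
  congr 1
  funext c
  by_cases hc : c ∈ Λ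
  · simp only [cutoff_apply, if_pos hc]; exact inv_mul_cancel _
  · simp only [cutoff_apply, if_neg hc, mul_one]

/-- **`(u·Q^{s*}(cut-off·w))′_Λ = u′_Λ`** — the translated variable does not see a substituted cut-off block field (standing range). [cite: BalabanImbrieJaffe1988, (5.3.1) p.280] -/
theorem uCut_surfMul_cutoff (hj : j + 1 ≤ P.m + P.K) (U : GaugeField P j U1) (w : GaugeField P (j+1) U1) :
    surfMul (surfMul U (cutoff Λ w)) (cutoff Λ (fun c => (qU (surfMul U (cutoff Λ w)) c)⁻¹)) = surfMul U (cutoff Λ (fun c => (qU U c)⁻¹)) := by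
  rw [qU_surfMul hj, surfMul_surfMul]
  congr 1
  funext c
  by_cases hc : c ∈ Λ
  · simp only [cutoff_apply, if_pos hc]
    rw [mul_inv_rev, mul_inv_cancel_left]
  · simp only [cutoff_apply, if_neg hc, mul_one]

/-- **(5.3.6) AT FIELD LEVEL: `Q(u′_Λ·Q^{s*}(cut-off·v))_c = v_c` for `c ∈ Λ`, `= (Qu)_c` for `c ∉ Λ`** — *"it removes the v-field from the
δ-functions there"*: on `Λ₁^{(k)′*}` the δ-function `δ(v/Qu)` is identically satisfied after the translation, on the complement it is the
untranslated one (p31's `qU_transl_of_mem`/`qU_transl_of_not_mem` compute the same for an abstract `u′`; standing range). [cite: BalabanImbrieJaffe1988, (5.3.6) p.280] -/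
theorem qU_translCut (hj : j + 1 ≤ P.m + P.K) (U : GaugeField P j U1) (v : GaugeField P (j+1) U1) :
    qU (surfMul (surfMul U (cutoff Λ (fun c => (qU U c)⁻¹))) (cutoff Λ v)) = fun c => if c ∈ Λ then v c else qU U c := by
  rw [qU_surfMul hj, qU_uCut hj]
  funext c
  by_cases hc : c ∈ Λ <;> simp [cutoff_apply, hc]

/-- (5.3.6) on the cut-off: `cut-off·Q(u′_Λ·Q^{s*}(cut-off·v)) = cut-off·v`. [cite: BalabanImbrieJaffe1988, (5.3.6) p.280] -/
theorem cutoff_qU_translCut (hj : j + 1 ≤ P.m + P.K) (U : GaugeField P j U1) (v : GaugeField P (j+1) U1) :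
    cutoff Λ (qU (surfMul (surfMul U (cutoff Λ (fun c => (qU U c)⁻¹))) (cutoff Λ v))) = cutoff Λ v := by
  rw [qU_translCut hj]
  funext c
  by_cases hc : c ∈ Λ <;> simp [cutoff_apply, hc]

/-- (5.3.6) off the cut-off: `Q(u′_Λ·Q^{s*}(cut-off·v))_c = (Qu)_c`, `c ∉ Λ` — the factor `δ_{Λ₁^{(k)′*c}}(v/Qu)` stays. [cite: BalabanImbrieJaffe1988, (5.3.6) p.280] -/
theorem qU_translCut_of_not_mem (hj : j + 1 ≤ P.m + P.K) (U : GaugeField P j U1) (v : GaugeField P (j+1) U1) {c : PBond P (j+1)}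
    (hc : c ∉ Λ) : qU (surfMul (surfMul U (cutoff Λ (fun c => (qU U c)⁻¹))) (cutoff Λ v)) c = qU U c := by
  rw [qU_translCut hj]; simp [hc]

/-- consistency: with `Λ` = all bonds the translated variable is r18's `u′` of [2] (3.9) (the companion file's variable). [cite: BalabanImbrieJaffe1988, (5.3.1) p.280] -/
theorem uCut_univ (U : GaugeField P j U1) : surfMul U (cutoff Finset.univ (fun c => (qU U c)⁻¹)) = uPrime U := by
  rw [cutoff_univ]; rfl

/-- consistency: with `Λ` = all bonds the cut-off translation is the whole-torus translation `u′·Q^{s*}v` of `BIJ88Eq531TranslLaw`. [cite: BalabanImbrieJaffe1988, (5.3.1) p.280] -/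
theorem translCut_univ (U : GaugeField P j U1) (v : GaugeField P (j+1) U1) :
    surfMul (surfMul U (cutoff Finset.univ (fun c => (qU U c)⁻¹))) (cutoff Finset.univ v) = surfMul (uPrime U) v := by
  rw [uCut_univ, cutoff_univ]

/-- kernel: `u ↦ u′_Λ` is measurable. [cite: BalabanImbrieJaffe1988, (5.3.1) p.280] -/
theorem measurable_uCut (Λ : Finset (PBond P (j+1))) :
    Measurable fun U : GaugeField P j U1 => surfMul U (cutoff Λ (fun c => (qU U c)⁻¹)) := by
  have h : Measurable fun U : GaugeField P j U1 => fun c => (qU U c)⁻¹ :=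
    measurable_pi_iff.mpr fun c => ((measurable_pi_apply c).comp measurable_qU).inv
  exact measurable_surfMul₂.comp (measurable_id.prodMk ((measurable_cutoff Λ).comp h))

/-- kernel: `u ↦ (u′_Λ, cut-off·Qu)` is measurable. [cite: BalabanImbrieJaffe1988, (5.3.1) p.280] -/
theorem measurable_graphCut (Λ : Finset (PBond P (j+1))) :
    Measurable fun U : GaugeField P j U1 => (surfMul U (cutoff Λ (fun c => (qU U c)⁻¹)), cutoff Λ (qU U)) :=
  (measurable_uCut Λ).prodMk ((measurable_cutoff Λ).comp measurable_qU)

/-- kernel: the cut-off translation `(u, v) ↦ u′_Λ(u)·Q^{s*}(cut-off·v)` is jointly measurable. [cite: BalabanImbrieJaffe1988, (5.3.1) p.280] -/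
theorem measurable_translCut (Λ : Finset (PBond P (j+1))) :
    Measurable fun p : GaugeField P j U1 × GaugeField P (j+1) U1 => surfMul (surfMul p.1 (cutoff Λ (fun c => (qU p.1 c)⁻¹))) (cutoff Λ p.2) := by
  have h1 : Measurable fun p : GaugeField P j U1 × GaugeField P (j+1) U1 => (surfMul p.1 (cutoff Λ (fun c => (qU p.1 c)⁻¹)), cutoff Λ p.2) :=
    ((measurable_uCut Λ).comp measurable_fst).prodMk ((measurable_cutoff Λ).comp measurable_snd)
  have h2 := measurable_surfMul₂.comp h1
  simpa only [Function.comp_def] using h2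

/-! ## §3 The joint law of `(u′_Λ, cut-off·Qu)` -/

section Law

variable {ν : Measure (GaugeField P j U1)} [IsProbabilityMeasure ν]

/-- **AVERAGING OUT THE `Λ`-COMPONENTS OF THE BLOCK FIELD.**  For a probability law `ν` invariant under all substitutions `u ↦ u·Q^{s*}w` and a
jointly measurable `J(u, v) ≥ 0` with `J(u·Q^{s*}(cut-off·w), ·) = J(u, ·)`: `∫ν J(u, cut-off·Qu) = ∫ν ∫dv J(u, cut-off·v)` (Haar invariance of `dv`
under `v ↦ (Qu)·v`, Tonelli, `cut-off·Q(u·Q^{s*}(cut-off·w)) = (cut-off·Qu)·(cut-off·w)`, invariance of `ν` and `J`; standing range). [cite: BalabanImbrieJaffe1988, (5.3.1) p.280] -/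
theorem lintegral_cutoff_qU_eq (hj : j + 1 ≤ P.m + P.K) (hν : ∀ w, ν.map (fun U => surfMul U w) = ν)
    {J : GaugeField P j U1 → GaugeField P (j+1) U1 → ℝ≥0∞} (hJ : Measurable (uncurry J))
    (hJinv : ∀ U w, J (surfMul U (cutoff Λ w)) = J U) :
    ∫⁻ U, J U (cutoff Λ (qU U)) ∂ν = ∫⁻ U, ∫⁻ v, J U (cutoff Λ v) ∂fieldMeasure P (j+1) U1 ∂ν := by
  have hJU : ∀ U, Measurable (J U) := fun U => hJ.comp measurable_prodMk_left
  have hm1 : Measurable fun p : GaugeField P j U1 × GaugeField P (j+1) U1 => J p.1 (cutoff Λ (fun c => qU p.1 c * p.2 c)) := by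
    have h : Measurable fun p : GaugeField P j U1 × GaugeField P (j+1) U1 => (p.1, cutoff Λ (fun c => qU p.1 c * p.2 c)) :=
      measurable_fst.prodMk ((measurable_cutoff Λ).comp (measurable_pi_iff.mpr fun c =>
        ((measurable_pi_apply c).comp (measurable_qU.comp measurable_fst)).mul ((measurable_pi_apply c).comp measurable_snd)))
    exact hJ.comp h
  have hm2 : Measurable fun U : GaugeField P j U1 => J U (cutoff Λ (qU U)) :=
    hJ.comp (measurable_id.prodMk ((measurable_cutoff Λ).comp measurable_qU))
  symm
  calc ∫⁻ U, ∫⁻ v, J U (cutoff Λ v) ∂fieldMeasure P (j+1) U1 ∂ν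
      = ∫⁻ U, ∫⁻ w, J U (cutoff Λ (fun c => qU U c * w c)) ∂fieldMeasure P (j+1) U1 ∂ν := by
        refine lintegral_congr fun U => ?_
        exact ((AveragingRT.measurePreserving_mulLeft (P := P) (j := j+1) (G := U1) (qU U)).lintegral_comp
          ((hJU U).comp (measurable_cutoff Λ))).symm
    _ = ∫⁻ w, ∫⁻ U, J U (cutoff Λ (fun c => qU U c * w c)) ∂ν ∂fieldMeasure P (j+1) U1 :=
        lintegral_lintegral_swap hm1.aemeasurable
    _ = ∫⁻ w, ∫⁻ U, J (surfMul U (cutoff Λ w)) (cutoff Λ (qU (surfMul U (cutoff Λ w)))) ∂ν ∂fieldMeasure P (j+1) U1 := by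
        refine lintegral_congr fun w => lintegral_congr fun U => ?_
        rw [qU_surfMul hj, hJinv]
        congr 1
        funext c
        by_cases hc : c ∈ Λ <;> simp [cutoff_apply, hc]
    _ = ∫⁻ w, ∫⁻ U, J U (cutoff Λ (qU U)) ∂ν ∂fieldMeasure P (j+1) U1 := by
        refine lintegral_congr fun w => ?_
        exact lintegral_comp_surfMul hν (cutoff Λ w) hm2
    _ = ∫⁻ U, J U (cutoff Λ (qU U)) ∂ν := by
        rw [lintegral_const, measure_univ, mul_one]

/-- **THE JOINT LAW WITH CUT-OFF: `law(u′_Λ, cut-off·Qu) = law(u′_Λ) ⊗ (cut-off)_*dv`.**  Under every substitution-invariant probability law `ν`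
of `u` (`𝒟u`, `𝒟u δ_{Ax}(u)`) the translated variable `u′_Λ` and the `Λ`-components of the block field `v = Qu` are INDEPENDENT, the latter
distributed by (the cut-off image of) the Haar measure `dv` — the measure-level content of *"it removes the v-field from the δ-functions there"*
(`lintegral_cutoff_qU_eq` on indicators with `(u·Q^{s*}(cut-off·w))′_Λ = u′_Λ`). [cite: BalabanImbrieJaffe1988, (5.3.6) p.280] -/
theorem map_graphCut_eq_prod (hj : j + 1 ≤ P.m + P.K) (hν : ∀ w, ν.map (fun U => surfMul U w) = ν) :
    ν.map (fun U => (surfMul U (cutoff Λ (fun c => (qU U c)⁻¹)), cutoff Λ (qU U))) =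
      (ν.map fun U => surfMul U (cutoff Λ (fun c => (qU U c)⁻¹))).prod ((fieldMeasure P (j+1) U1).map (cutoff Λ)) := by
  haveI : IsProbabilityMeasure (ν.map fun U : GaugeField P j U1 => surfMul U (cutoff Λ (fun c => (qU U c)⁻¹))) :=
    Measure.isProbabilityMeasure_map (measurable_uCut Λ).aemeasurable
  haveI : IsProbabilityMeasure ((fieldMeasure P (j+1) U1).map (cutoff Λ)) :=
    Measure.isProbabilityMeasure_map (measurable_cutoff Λ).aemeasurable
  ext S hS
  rw [Measure.map_apply (measurable_graphCut Λ) hS, Measure.prod_apply hS,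
    lintegral_map (measurable_measure_prodMk_left hS) (measurable_uCut Λ), ← lintegral_indicator_one ((measurable_graphCut Λ) hS)]
  have e1 : ∀ U : GaugeField P j U1,
      ((fun U => (surfMul U (cutoff Λ (fun c => (qU U c)⁻¹)), cutoff Λ (qU U))) ⁻¹' S).indicator (1 : GaugeField P j U1 → ℝ≥0∞) U =
        S.indicator 1 (surfMul U (cutoff Λ (fun c => (qU U c)⁻¹)), cutoff Λ (qU U)) := fun U => rfl
  have e2 : ∀ U : GaugeField P j U1, ((fieldMeasure P (j+1) U1).map (cutoff Λ)) (Prod.mk (surfMul U (cutoff Λ (fun c => (qU U c)⁻¹))) ⁻¹' S) =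
      ∫⁻ v, S.indicator 1 (surfMul U (cutoff Λ (fun c => (qU U c)⁻¹)), cutoff Λ v) ∂fieldMeasure P (j+1) U1 := fun U => by
    rw [Measure.map_apply (measurable_cutoff Λ) (measurable_prodMk_left hS),
      ← lintegral_indicator_one ((measurable_cutoff Λ) (measurable_prodMk_left hS))]
    rfl
  simp_rw [e1, e2]
  refine lintegral_cutoff_qU_eq hj hν (J := fun U v => S.indicator 1 (surfMul U (cutoff Λ (fun c => (qU U c)⁻¹)), v)) ?_ ?_
  · exact (measurable_const.indicator hS).comp (((measurable_uCut Λ).comp measurable_fst).prodMk measurable_snd)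
  · intro U w
    funext v
    show S.indicator 1 (surfMul (surfMul U (cutoff Λ w)) (cutoff Λ (fun c => (qU (surfMul U (cutoff Λ w)) c)⁻¹)), v) =
      S.indicator 1 (surfMul U (cutoff Λ (fun c => (qU U c)⁻¹)), v)
    rw [uCut_surfMul_cutoff hj]

/-- `u ↦ (u′_Λ, cut-off·Qu)` is measure preserving `ν → law(u′_Λ) ⊗ (cut-off)_*dv`. [cite: BalabanImbrieJaffe1988, (5.3.6) p.280] -/
theorem measurePreserving_graphCut (hj : j + 1 ≤ P.m + P.K) (hν : ∀ w, ν.map (fun U => surfMul U w) = ν) :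
    MeasurePreserving (fun U => (surfMul U (cutoff Λ (fun c => (qU U c)⁻¹)), cutoff Λ (qU U))) ν
      ((ν.map fun U => surfMul U (cutoff Λ (fun c => (qU U c)⁻¹))).prod ((fieldMeasure P (j+1) U1).map (cutoff Λ))) :=
  ⟨measurable_graphCut Λ, map_graphCut_eq_prod hj hν⟩

/-- kernel: the cut-off translation pushes `law(u′_Λ) ⊗ dv` back to `ν` (`u′_Λ·Q^{s*}(cut-off·Qu) = u`, `cut-off` applied to `dv`). [cite: BalabanImbrieJaffe1988, (5.3.1) p.280] -/
theorem map_translCut_prod (hj : j + 1 ≤ P.m + P.K) (hν : ∀ w, ν.map (fun U => surfMul U w) = ν) :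
    ((ν.map fun U => surfMul U (cutoff Λ (fun c => (qU U c)⁻¹))).prod (fieldMeasure P (j+1) U1)).map
        (fun p : GaugeField P j U1 × GaugeField P (j+1) U1 => surfMul p.1 (cutoff Λ p.2)) = ν := by
  have h1 : ((ν.map fun U => surfMul U (cutoff Λ (fun c => (qU U c)⁻¹))).prod (fieldMeasure P (j+1) U1)).map (Prod.map id (cutoff Λ)) =
      (ν.map fun U => surfMul U (cutoff Λ (fun c => (qU U c)⁻¹))).prod ((fieldMeasure P (j+1) U1).map (cutoff Λ)) :=
    ((MeasurePreserving.id _).prod ⟨measurable_cutoff Λ, rfl⟩).map_eq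
  have e : (fun p : GaugeField P j U1 × GaugeField P (j+1) U1 => surfMul p.1 (cutoff Λ p.2)) =
      (fun p : GaugeField P j U1 × GaugeField P (j+1) U1 => surfMul p.1 p.2) ∘ Prod.map id (cutoff Λ) := by
    funext p; rfl
  rw [e, ← Measure.map_map measurable_surfMul₂ (measurable_id.prodMap (measurable_cutoff Λ)), h1, ← map_graphCut_eq_prod hj hν,
    Measure.map_map measurable_surfMul₂ (measurable_graphCut Λ)]
  have e2 : (fun p : GaugeField P j U1 × GaugeField P (j+1) U1 => surfMul p.1 p.2) ∘
      (fun U => (surfMul U (cutoff Λ (fun c => (qU U c)⁻¹)), cutoff Λ (qU U))) = id :=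
    funext fun U => surfMul_uCut_cutoff_qU Λ U
  rw [e2, Measure.map_id]

/-- **THE CUT-OFF TRANSLATION IS MEASURE PRESERVING: `(u, v) ↦ u′_Λ(u)·Q^{s*}(cut-off·v)` carries `ν ⊗ dv` onto `ν`** for every
substitution-invariant probability law `ν` (`𝒟u`, `𝒟u δ_{Ax}(u)`) — the change of variables (5.3.1) with `u′ = u′_Λ(u)` under the `u`-integral. [cite: BalabanImbrieJaffe1988, (5.3.1) p.280] -/
theorem measurePreserving_translCut (hj : j + 1 ≤ P.m + P.K) (hν : ∀ w, ν.map (fun U => surfMul U w) = ν) :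
    MeasurePreserving (fun p : GaugeField P j U1 × GaugeField P (j+1) U1 => surfMul (surfMul p.1 (cutoff Λ (fun c => (qU p.1 c)⁻¹))) (cutoff Λ p.2))
      (ν.prod (fieldMeasure P (j+1) U1)) ν := by
  have h1 : MeasurePreserving (Prod.map (fun U : GaugeField P j U1 => surfMul U (cutoff Λ (fun c => (qU U c)⁻¹))) (id : GaugeField P (j+1) U1 → _))
      (ν.prod (fieldMeasure P (j+1) U1)) ((ν.map fun U => surfMul U (cutoff Λ (fun c => (qU U c)⁻¹))).prod (fieldMeasure P (j+1) U1)) :=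
    (⟨measurable_uCut Λ, rfl⟩ : MeasurePreserving (fun U : GaugeField P j U1 => surfMul U (cutoff Λ (fun c => (qU U c)⁻¹))) ν
      (ν.map fun U => surfMul U (cutoff Λ (fun c => (qU U c)⁻¹)))).prod (MeasurePreserving.id _)
  have h2 : MeasurePreserving (fun p : GaugeField P j U1 × GaugeField P (j+1) U1 => surfMul p.1 (cutoff Λ p.2))
      ((ν.map fun U => surfMul U (cutoff Λ (fun c => (qU U c)⁻¹))).prod (fieldMeasure P (j+1) U1)) ν :=
    ⟨measurable_surfMul₂.comp (measurable_fst.prodMk ((measurable_cutoff Λ).comp measurable_snd)), map_translCut_prod hj hν⟩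
  exact h2.comp h1

/-! ## §4 Integrals after the cut-off translation -/

/-- **`∫ν F(u) = ∫ν ∫dv F(u′_Λ·Q^{s*}(cut-off·v))`** for measurable `F ≥ 0`. [cite: BalabanImbrieJaffe1988, (5.3.1) p.280] -/
theorem lintegral_eq_translCut (hj : j + 1 ≤ P.m + P.K) (hν : ∀ w, ν.map (fun U => surfMul U w) = ν)
    {F : GaugeField P j U1 → ℝ≥0∞} (hF : Measurable F) :
    ∫⁻ U, F U ∂ν = ∫⁻ U, ∫⁻ v, F (surfMul (surfMul U (cutoff Λ (fun c => (qU U c)⁻¹))) (cutoff Λ v)) ∂fieldMeasure P (j+1) U1 ∂ν := by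
  rw [← (measurePreserving_translCut hj hν).lintegral_comp hF]
  exact lintegral_prod _ (hF.comp (measurePreserving_translCut (Λ := Λ) hj hν).measurable).aemeasurable

/-- **`∫ν F(u) = ∫ν ∫dv F(u′_Λ·Q^{s*}(cut-off·v))`** for a `ν`-integrable `F` (real Banach values): the `u`-integral rewritten in the translated
variables of (5.3.1), with the cut-off. [cite: BalabanImbrieJaffe1988, (5.3.1) p.280] -/
theorem integral_eq_translCut (hj : j + 1 ≤ P.m + P.K) (hν : ∀ w, ν.map (fun U => surfMul U w) = ν)
    {E : Type*} [NormedAddCommGroup E] [NormedSpace ℝ E] {F : GaugeField P j U1 → E} (hF : Integrable F ν) :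
    ∫ U, F U ∂ν = ∫ U, ∫ v, F (surfMul (surfMul U (cutoff Λ (fun c => (qU U c)⁻¹))) (cutoff Λ v)) ∂fieldMeasure P (j+1) U1 ∂ν := by
  have hΨ := measurePreserving_translCut (Λ := Λ) hj hν
  have hI : Integrable (fun p : GaugeField P j U1 × GaugeField P (j+1) U1 =>
      F (surfMul (surfMul p.1 (cutoff Λ (fun c => (qU p.1 c)⁻¹))) (cutoff Λ p.2))) (ν.prod (fieldMeasure P (j+1) U1)) :=
    (hΨ.integrable_comp hF.aestronglyMeasurable).2 hF
  have h1 : ∫ U, F U ∂ν = ∫ p, F (surfMul (surfMul p.1 (cutoff Λ (fun c => (qU p.1 c)⁻¹))) (cutoff Λ p.2)) ∂ν.prod (fieldMeasure P (j+1) U1) := by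
    have hF' : AEStronglyMeasurable F (Measure.map (fun p : GaugeField P j U1 × GaugeField P (j+1) U1 =>
        surfMul (surfMul p.1 (cutoff Λ (fun c => (qU p.1 c)⁻¹))) (cutoff Λ p.2)) (ν.prod (fieldMeasure P (j+1) U1))) := by
      rw [hΨ.map_eq]; exact hF.aestronglyMeasurable
    rw [← integral_map hΨ.measurable.aemeasurable hF', hΨ.map_eq]
  rw [h1, integral_prod _ hI]

/-- **THE TEST-FUNCTION FORM OF (5.3.6)**: for `ν`-integrable `F` and bounded measurable `g` of the block field, `∫ν F(u) g(Qu) = ∫ν ∫dv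
F(u′_Λ·Q^{s*}(cut-off·v)) g(v|_Λ, Qu|_{Λᶜ})` — integrated against `δ(v/Qu) dv`, the `Λ`-components of `v` are freed (Haar) while the
`Λᶜ`-components remain tied to `Qu = Qu′_Λ` there: *"δ(v/Qu) = δ_{Λ₁^{(k)′*c}}(v/Qu) δ_{Λ₁^{(k)′*}}(…)"*. [cite: BalabanImbrieJaffe1988, (5.3.6) p.280] -/
theorem integral_mul_comp_qU_eq_translCut (hj : j + 1 ≤ P.m + P.K) (hν : ∀ w, ν.map (fun U => surfMul U w) = ν)
    {F : GaugeField P j U1 → ℂ} (hF : Integrable F ν) {g : GaugeField P (j+1) U1 → ℂ} (hg : Measurable g) {C : ℝ}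
    (hC : ∀ v, ‖g v‖ ≤ C) :
    ∫ U, F U * g (qU U) ∂ν = ∫ U, ∫ v, F (surfMul (surfMul U (cutoff Λ (fun c => (qU U c)⁻¹))) (cutoff Λ v)) *
      g (fun c => if c ∈ Λ then v c else qU U c) ∂fieldMeasure P (j+1) U1 ∂ν := by
  have hFg : Integrable (fun U => F U * g (qU U)) ν :=
    hF.mul_bdd (hg.comp measurable_qU).aestronglyMeasurable (Filter.Eventually.of_forall fun U => hC _)
  rw [integral_eq_translCut (Λ := Λ) hj hν hFg]
  simp only [qU_translCut hj]

end Law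

/-! ## §5 The instances of record -/

/-- instance `ν = 𝒟u δ_{Ax}(u)` (the measure of (5.1.1) with (5.1.4)): `law(u′_Λ, cut-off·Qu) = law(u′_Λ) ⊗ (cut-off)_*dv`. [cite: BalabanImbrieJaffe1988, (5.3.6) p.280] -/
theorem map_graphCut_axialMeasure (hj : j + 1 ≤ P.m + P.K) (Λ : Finset (PBond P (j+1))) :
    (axialMeasure P j U1).map (fun U => (surfMul U (cutoff Λ (fun c => (qU U c)⁻¹)), cutoff Λ (qU U))) =
      ((axialMeasure P j U1).map fun U => surfMul U (cutoff Λ (fun c => (qU U c)⁻¹))).prod ((fieldMeasure P (j+1) U1).map (cutoff Λ)) :=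
  map_graphCut_eq_prod hj axialMeasure_map_surfMul

/-- instance `ν = 𝒟u`: `law(u′_Λ, cut-off·Qu) = law(u′_Λ) ⊗ (cut-off)_*dv`. [cite: BalabanImbrieJaffe1988, (5.3.6) p.280] -/
theorem map_graphCut_fieldMeasure (hj : j + 1 ≤ P.m + P.K) (Λ : Finset (PBond P (j+1))) :
    (fieldMeasure P j U1).map (fun U => (surfMul U (cutoff Λ (fun c => (qU U c)⁻¹)), cutoff Λ (qU U))) =
      ((fieldMeasure P j U1).map fun U => surfMul U (cutoff Λ (fun c => (qU U c)⁻¹))).prod ((fieldMeasure P (j+1) U1).map (cutoff Λ)) :=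
  map_graphCut_eq_prod hj map_surfMul_fieldMeasure

/-- instance `ν = 𝒟u δ_{Ax}(u)`: `∫𝒟u δ_{Ax} F(u) = ∫𝒟u δ_{Ax} ∫dv F(u′_Λ·Q^{s*}(cut-off·v))`. [cite: BalabanImbrieJaffe1988, (5.3.1) p.280] -/
theorem integral_axialMeasure_eq_translCut (hj : j + 1 ≤ P.m + P.K) (Λ : Finset (PBond P (j+1))) {E : Type*} [NormedAddCommGroup E]
    [NormedSpace ℝ E] {F : GaugeField P j U1 → E} (hF : Integrable F (axialMeasure P j U1)) :
    ∫ U, F U ∂axialMeasure P j U1 =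
      ∫ U, ∫ v, F (surfMul (surfMul U (cutoff Λ (fun c => (qU U c)⁻¹))) (cutoff Λ v)) ∂fieldMeasure P (j+1) U1 ∂axialMeasure P j U1 :=
  integral_eq_translCut hj axialMeasure_map_surfMul hF

/-- instance `ν = 𝒟u δ_{Ax}(u)`: `∫𝒟u δ_{Ax} F(u) g(Qu) = ∫𝒟u δ_{Ax} ∫dv F(u′_Λ·Q^{s*}(cut-off·v)) g(v|_Λ, Qu|_{Λᶜ})` — (5.3.6) under the
`u`-integral of (5.1.1). [cite: BalabanImbrieJaffe1988, (5.3.6) p.280] -/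
theorem integral_mul_comp_qU_axialMeasure_cut (hj : j + 1 ≤ P.m + P.K) (Λ : Finset (PBond P (j+1))) {F : GaugeField P j U1 → ℂ}
    (hF : Integrable F (axialMeasure P j U1)) {g : GaugeField P (j+1) U1 → ℂ} (hg : Measurable g) {C : ℝ} (hC : ∀ v, ‖g v‖ ≤ C) :
    ∫ U, F U * g (qU U) ∂axialMeasure P j U1 = ∫ U, ∫ v, F (surfMul (surfMul U (cutoff Λ (fun c => (qU U c)⁻¹))) (cutoff Λ v)) *
      g (fun c => if c ∈ Λ then v c else qU U c) ∂fieldMeasure P (j+1) U1 ∂axialMeasure P j U1 :=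
  integral_mul_comp_qU_eq_translCut hj axialMeasure_map_surfMul hF hg hC

end

end Literature.MathematicalPhysics.QuantumFieldTheory.BalabanImbrieJaffe1984to88.BIJ88Eq531TranslLawCutoff
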